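import Summits.QuantumFields.BalabanUV.Beta.GAN24.CombTowerEndOfSlotsK
import Summits.QuantumFields.BalabanUV.Beta.GAN24.CombWrecEvenHalfRows
import Summits.QuantumFields.BalabanUV.Beta.GAN24.CombSpureRowsOfSRows

/-!
# `BalabanUV.Beta.GAN24.CombTowerEndOfT2ev` — binder row G-an2-4 ∕ (CONV-C), TRANSFER-III: **THE G-an2-4 END AT ROW D1's LITERAL OF RECORD (III′) WITH THE W-SLOT READ
# THROUGH THE EVEN MEMBER's TWO T₂ ROWS** — MY K-discharged even-half END `CombTowerEndOfSlotsK` §5 (⟸ leaf-01 g79's `CombChartSlotJunction` ⟸ the OWNER's T1 §5) with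
# its even-half W-rows `(hW, hWall)` SUPPLIED by MY L9 twin `CombWrecEvenHalfRows` §3 ∕ §4: the `AllScalesSeq` statement for `TbalOf Lc (JsB12CombShSym hLc N tabs cΛ cB) j`
# and row D1's two readings ⟸ the S-slot rows on `unitS_j (ScombOf …)` ∧ «S′Shape» ∕ «S′Drift» on `unitS_j (SpureCombOf …)` ∧ «T2Shape^{ev}» ∧ «T2Drift^{ev}»
# (+ for a generic record: the multiplier-slot rows, the table parities and the mixed block letters; at an1's record `symTablesAn1S2 3 Lc cΛt` NOTHING else)
# (G-an2-4 CRUX TEAM (2), leaf prover `b2b-balaban-gan24-formalise-leaf-02`, gen 79; R-gan24p1-g46-1 (c): the K-discharged (III′) ENDs are this lineage's)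

NOT IN PRINT; OUR BOOKKEEPING ([folklore] composition BY NAME, two `obtain`s per theorem; 0 `def`, 0 cited fact, 0 `def … : Prop`, 0 sorry).
HONEST FRAMING (cell contract, verbatim): «discharging `BetaPertH` makes Bałaban's UV stability UNCONDITIONAL — a real constructive-QFT result; it is NOT the continuum
limit and NOT the Clay problem.»  HONEST DEPENDENCY (verbatim): «continuum YM on T⁴ ⇐ BetaPertH ∧ nine spine estimates (0/9 proved); BetaPertH ⇐ (D1) ∧ (D4) ∧ CAP+tail;
G-an2-4 gates asym, D1 and NE2/3/4.»

WHAT (`d = 3`, `Lc` odd, `2 ≤ Lc`, every `SU(N)`, pins `cE = Lc⁴`, `cVH = −Lc⁸∕2`, `cE₂ = Lc⁸`, `Tc = (8N²)⁻¹ • wsym22 N`, every `cΛ cB`, channel `(μ, ν)`):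
* §1 **`exists_allScalesSeq_JsB12CombShSym_of_slots_T2ev`** (ANY `tabs : SymTables 3 Lc`): `∃ κ θ, 0 ≤ θ ∧ θ < 1 ∧ AllScalesSeq (j ↦ secondMoment (TbalOf Lc (JsB12CombShSym …) j) μ ν) κ θ`
  ⟸ (hS, hSall) on `unitS_j (ScombOf tabs …)` ∧ (hSp, hSpall) on `unitS_j (SpureCombOf tabs …)` ∧ (hM, hMall) on `unitM_j (tabs.M j)` ∧ parities (V-p)(H-p)(M-p) ∧ «T2Shape^{ev}» `hT₂` ∧
  «T2Drift^{ev}» `hT₂d` ∧ the mixed block letters `hfm hm` (K discharged twice: `KSlotCombChart.kSlotCombSh_holds`).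
* §2 **`exists_allScalesSeq_JsB12CombShSym_an1_of_slots_T2ev`** (an1's record `symTablesAn1S2 3 Lc cΛt`): ⟸ (hS, hSall) ∧ (hSp, hSpall) ∧ «T2Shape^{ev}» ∧ «T2Drift^{ev}» ONLY;
  **`d1Drift_JsB12CombShSym_an1_iff_lim_eq_of_slots_T2ev`** ∕ **`d1Drift_JsB12CombShSym_an1_iff_cesaro_of_slots_T2ev`** — row D1's two READINGS of the wall under the same rows.
* §3 (v1.1, APPEND-ONLY) **`exists_allScalesSeq_JsB12CombShSym_an1_of_sRows_T2ev`**, **`d1Drift_JsB12CombShSym_an1_iff_lim_eq_of_sRows_T2ev`**,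
  **`d1Drift_JsB12CombShSym_an1_iff_cesaro_of_sRows_T2ev`** — §2 with the S′-rows `(hSp, hSpall)` SUPPLIED from `(hS, hSall)` by MY `CombSpureRowsOfSRows`
  (`exists_spureCombOf_rows_three_of_scombOf_rows`: the peel `S′ = S − Λ(H)` over an1's `symHessFFAt`, K by road P1's `convCKWall_holds`): the (III′) END at an1's record
  ⟸ (hS, hSall) on `unitS_j (ScombOf …)` ∧ «T2Shape^{ev}» ∧ «T2Drift^{ev}» ONLY (and, through `CombTowerEndOfSlotsK` §6 ∕ road-P2's M.53, ⟸ four sector letters ∧ two T₂ rows).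
READING (zero weight): the (III′) END's W-side now reads the OWNER's T4 `CombT2ShapeEvenEnd` ∕ T5 `CombT2DriftEvenEnd` CONCLUSIONS (the two T₂ rows) — L9 of (α-0) at (III′) is
composed; the S-side reads road-P2's sector letters through `CombTowerEndOfSlotsK` §6 (the S′-rows of `SpureCombOf` are the S-campaign's).  Asserts NO value of Bałaban's tables;
discharges NO S-∕S′-row, NO T₂ row (`hb ∕ hZ ∕ hy ∕ hbd ∕ hcell ∕ hcelld` of T4 ∕ T5 untouched), NO value `lim β = stepBal` (row D1's); the (III′) campaign is NOT asked (an2 W-4);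
NEVER «G-an2-4 closed» as (CONV-C); NOT D1, NOT `BetaPertH`, NOT continuum, NOT Clay.  2026-08-25; no existing file touched (v1.1 = v1 + §3, §1–§2 byte-identical).
-/

noncomputable section

open Literature.MathematicalPhysics.QuantumFieldTheory
open Literature.MathematicalPhysics.QuantumFieldTheory.Balaban1983to89
open Literature.MathematicalPhysics.QuantumFieldTheory.Balaban1983to89.Beta
open Filter Topology
open scoped BigOperators
open RemainderConstAllScales (AllScalesSeq)
open ExpKernelCalculus (MKer Decays VertexFamily)
open OneStepResolventKernel (Fib LocStencil)
open OneStepKernelFamily (TbalOf D1Drift)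
open BalabanCompositeJets (LocStencil₂)
open WilsonVertex2Sym (wsym22)
open AveragingContoursRooted (ctr)
open Summit.QuantumFields.BalabanUV.Beta.TameKernelCalculus (trK)
open Summit.QuantumFields.BalabanUV.Beta.BorderedHessian (sgnK)
open Summit.QuantumFields.BalabanUV.Beta.HessKerDressedUnits (unitS unitW)
open Summit.QuantumFields.BalabanUV.Beta.SecondOrderUnits (unitM unitS₂)
open Summit.QuantumFields.BalabanUV.Beta.SpineRooted (T2RecOf)
open Summit.QuantumFields.BalabanUV.Beta.SymmetrisedStepJets (SymTables)
open Summit.QuantumFields.BalabanUV.Beta.CombChartStepJets (GcombSh ScombOf SpureCombOf WcombOf)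
open Summit.QuantumFields.BalabanUV.Beta.CombChartJointEnd (JsB12CombShSym)
open Summit.QuantumFields.BalabanUV.Beta.SymSecondOrderTablesAn1 (symTablesAn1S2)
open Summit.QuantumFields.BalabanUV.Beta.GAN24.CombesThomas (sfStep smStep)
open Summit.QuantumFields.BalabanUV.Beta.GAN24.KSlotCombChart (kSlotCombSh_holds)
open Summit.QuantumFields.BalabanUV.Beta.GAN24.CombTowerEndOfSlotsK (exists_allScalesSeq_JsB12CombShSym_of_slots_evenHalf
  d1Drift_JsB12CombShSym_iff_lim_eq_of_slots_evenHalf d1Drift_JsB12CombShSym_iff_cesaro_of_slots_evenHalf)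
open Summit.QuantumFields.BalabanUV.Beta.GAN24.CombWrecEvenHalfRows (hW_hWall_evenHalf_WcombOf_of_shapes hW_hWall_evenHalf_WcombOf_an1_three)
open Summit.QuantumFields.BalabanUV.Beta.GAN24.CombSpureRowsOfSRows (exists_spureCombOf_rows_three_of_scombOf_rows)

namespace Summit.QuantumFields.BalabanUV.Beta.GAN24.CombTowerEndOfT2ev

variable {Lc : ℕ} [NeZero Lc] {Cs cS δS θS Cp cP δP θP CM cM δM θM C₂ c₂ δ₂ θ₂ : ℝ}

/-! ## §1 Any sym record: the END ⟸ S-rows ∧ S′-rows ∧ M-rows ∧ parities ∧ «T2Shape^{ev}» ∧ «T2Drift^{ev}» -/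

/-- [our object; folklore composition] **THE G-an2-4 END AT (III′), W-SLOT READ THROUGH THE TWO T₂ ROWS OF THE EVEN MEMBER** (ANY `tabs : SymTables 3 Lc`; `Lc` odd, `2 ≤ Lc`):
§5 of `CombTowerEndOfSlotsK` with its even-half W-rows supplied by `CombWrecEvenHalfRows.hW_hWall_evenHalf_WcombOf_of_shapes` (K-rows by `kSlotCombSh_holds`). -/
theorem exists_allScalesSeq_JsB12CombShSym_of_slots_T2ev (hLc : Odd Lc) (hLc2 : 2 ≤ Lc) (N : ℕ) (tabs : SymTables 3 Lc) (cΛ cB : ℝ)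
    (hS : ∀ j, LocStencil (unitS (sfStep Lc j) (smStep 3 Lc j) (ScombOf tabs ((Lc : ℝ) ^ 4) (-((Lc : ℝ) ^ 8 / 2)) cΛ j)) Cs δS)
    (hSall : ∀ k j, LocStencil (unitS (sfStep Lc (k + j)) (smStep 3 Lc (k + j)) (ScombOf tabs ((Lc : ℝ) ^ 4) (-((Lc : ℝ) ^ 8 / 2)) cΛ (k + j)) -
      unitS (sfStep Lc k) (smStep 3 Lc k) (ScombOf tabs ((Lc : ℝ) ^ 4) (-((Lc : ℝ) ^ 8 / 2)) cΛ k)) (cS * θS ^ k) δS)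
    (hδS : 0 < δS) (hθS0 : 0 ≤ θS) (hθS1 : θS < 1)
    (hVp : ∀ (κ : Fin (3 + 1)) (u : Fin (3 + 1) → ℤ), trK (tabs.V κ u) = -sgnK (tabs.V κ u))
    (hHp : ∀ (μ : Fin (3 + 1)) (y : Fin (3 + 1) → ℤ), trK (tabs.H μ y) = -sgnK (tabs.H μ y))
    (hMp : ∀ (j : ℕ) (ρ : Fin (3 + 1)) (w : Fin (3 + 1) → ℤ), trK (tabs.M j ρ w) = -sgnK (tabs.M j ρ w))
    (hSp : ∀ j, LocStencil (unitS (sfStep Lc j) (smStep 3 Lc j) (SpureCombOf tabs ((Lc : ℝ) ^ 4) (-((Lc : ℝ) ^ 8 / 2)) cΛ j)) Cp δP)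
    (hSpall : ∀ k j, LocStencil (unitS (sfStep Lc (k + j)) (smStep 3 Lc (k + j)) (SpureCombOf tabs ((Lc : ℝ) ^ 4) (-((Lc : ℝ) ^ 8 / 2)) cΛ (k + j)) -
      unitS (sfStep Lc k) (smStep 3 Lc k) (SpureCombOf tabs ((Lc : ℝ) ^ 4) (-((Lc : ℝ) ^ 8 / 2)) cΛ k)) (cP * θP ^ k) δP)
    (hδP : 0 < δP) (hθP0 : 0 ≤ θP) (hθP1 : θP < 1)
    (hM : ∀ j, VertexFamily (unitM (sfStep Lc j) (smStep 3 Lc j) (tabs.M j)) Lc CM δM)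
    (hMall : ∀ k j, VertexFamily (unitM (sfStep Lc (k + j)) (smStep 3 Lc (k + j)) (tabs.M (k + j)) - unitM (sfStep Lc k) (smStep 3 Lc k) (tabs.M k)) Lc
      (cM * θM ^ k) δM)
    (hδM : 0 < δM) (hθM0 : 0 ≤ θM) (hθM1 : θM < 1)
    (hT₂ : ∀ j, LocStencil₂ (((1 : ℝ) / 2) • (unitS₂ (sfStep Lc j) (smStep 3 Lc j)
        (T2RecOf 3 Lc (GcombSh Lc) (SpureCombOf tabs ((Lc : ℝ) ^ 4) (-((Lc : ℝ) ^ 8 / 2)) cΛ) tabs.M ((Lc : ℝ) ^ 8) cB ((8 * (N : ℝ) ^ 2)⁻¹ • wsym22 N) tabs.vh₂S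
          tabs.mixFF j) + fun κ u κ' u' =>
      sgnK (trK (unitS₂ (sfStep Lc j) (smStep 3 Lc j) (T2RecOf 3 Lc (GcombSh Lc) (SpureCombOf tabs ((Lc : ℝ) ^ 4) (-((Lc : ℝ) ^ 8 / 2)) cΛ) tabs.M ((Lc : ℝ) ^ 8) cB
        ((8 * (N : ℝ) ^ 2)⁻¹ • wsym22 N) tabs.vh₂S tabs.mixFF j) κ u κ' u')))) C₂ δ₂)
    (hT₂d : ∀ k j, LocStencil₂ (((1 : ℝ) / 2) • (unitS₂ (sfStep Lc (k + j)) (smStep 3 Lc (k + j))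
          (T2RecOf 3 Lc (GcombSh Lc) (SpureCombOf tabs ((Lc : ℝ) ^ 4) (-((Lc : ℝ) ^ 8 / 2)) cΛ) tabs.M ((Lc : ℝ) ^ 8) cB ((8 * (N : ℝ) ^ 2)⁻¹ • wsym22 N) tabs.vh₂S
            tabs.mixFF (k + j)) + fun κ u κ' u' =>
        sgnK (trK (unitS₂ (sfStep Lc (k + j)) (smStep 3 Lc (k + j)) (T2RecOf 3 Lc (GcombSh Lc) (SpureCombOf tabs ((Lc : ℝ) ^ 4) (-((Lc : ℝ) ^ 8 / 2)) cΛ) tabs.M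
          ((Lc : ℝ) ^ 8) cB ((8 * (N : ℝ) ^ 2)⁻¹ • wsym22 N) tabs.vh₂S tabs.mixFF (k + j)) κ u κ' u'))) -
      ((1 : ℝ) / 2) • (unitS₂ (sfStep Lc k) (smStep 3 Lc k) (T2RecOf 3 Lc (GcombSh Lc) (SpureCombOf tabs ((Lc : ℝ) ^ 4) (-((Lc : ℝ) ^ 8 / 2)) cΛ) tabs.M ((Lc : ℝ) ^ 8)
            cB ((8 * (N : ℝ) ^ 2)⁻¹ • wsym22 N) tabs.vh₂S tabs.mixFF k) +
        fun κ u κ' u' => sgnK (trK (unitS₂ (sfStep Lc k) (smStep 3 Lc k) (T2RecOf 3 Lc (GcombSh Lc) (SpureCombOf tabs ((Lc : ℝ) ^ 4) (-((Lc : ℝ) ^ 8 / 2)) cΛ)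
          tabs.M ((Lc : ℝ) ^ 8) cB ((8 * (N : ℝ) ^ 2)⁻¹ • wsym22 N) tabs.vh₂S tabs.mixFF k) κ u κ' u')))) (c₂ * θ₂ ^ k) δ₂)
    (hδ₂ : 0 < δ₂) (hθ₂0 : 0 ≤ θ₂) (hθ₂1 : θ₂ < 1)
    (hfm : ∀ κ u ρ w x z (α μ' : Fin (3 + 1)), tabs.mixFF κ u ρ w x z (Sum.inl α) (Sum.inr μ') = 0)
    (hm : ∀ κ u ρ w x z (μ' : Fin (3 + 1)) (b : Fib 3), tabs.mixFF κ u ρ w x z (Sum.inr μ') b = 0) (μ ν : Fin 4) :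
    ∃ κ θ : ℝ, 0 ≤ θ ∧ θ < 1 ∧ AllScalesSeq (fun j => B12Beta.secondMoment (TbalOf Lc (JsB12CombShSym hLc N tabs cΛ cB) j) μ ν) κ θ := by
  obtain ⟨C, δK, cK, θK, hδK, hθK0, hθK1, hK, hKall⟩ := kSlotCombSh_holds hLc2
  obtain ⟨Cw, cW, θW, δW, hθW0, hθW1, hδW, hW, hWall⟩ := hW_hWall_evenHalf_WcombOf_of_shapes tabs ((Lc : ℝ) ^ 4) (-((Lc : ℝ) ^ 8 / 2)) cΛ ((Lc : ℝ) ^ 8) cB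
    ((8 * (N : ℝ) ^ 2)⁻¹ • wsym22 N) hK hKall hδK hθK0 hθK1 hVp hHp hMp hSp hSpall hδP hθP0 hθP1 hM hMall hδM hθM0 hθM1 hT₂ hT₂d hδ₂ hθ₂0 hθ₂1 hfm hm
  exact exists_allScalesSeq_JsB12CombShSym_of_slots_evenHalf hLc hLc2 N tabs cΛ cB hS hSall hW hWall hδS hδW hθS0 hθS1 hθW0 hθW1 μ ν

/-! ## §2 an1's record: the END and row D1's readings ⟸ S-rows ∧ S′-rows ∧ «T2Shape^{ev}» ∧ «T2Drift^{ev}» ONLY -/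

section An1

variable (cΛt : ℝ)

/-- [our object; folklore composition] **THE G-an2-4 END AT (III′) FOR an1's RECORD `symTablesAn1S2 3 Lc cΛt` ⟸ THE S-ROWS, THE S′-ROWS AND THE TWO T₂ ROWS ONLY**
(`Lc` odd, `2 ≤ Lc`; K-rows, M-rows, parities and mixed letters discharged inside `CombWrecEvenHalfRows.hW_hWall_evenHalf_WcombOf_an1_three`). -/
theorem exists_allScalesSeq_JsB12CombShSym_an1_of_slots_T2ev (hLc : Odd Lc) (hLc2 : 2 ≤ Lc) (N : ℕ) (cΛ cB : ℝ)
    (hS : ∀ j, LocStencil (unitS (sfStep Lc j) (smStep 3 Lc j) (ScombOf (symTablesAn1S2 3 Lc cΛt) ((Lc : ℝ) ^ 4) (-((Lc : ℝ) ^ 8 / 2)) cΛ j)) Cs δS)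
    (hSall : ∀ k j, LocStencil (unitS (sfStep Lc (k + j)) (smStep 3 Lc (k + j)) (ScombOf (symTablesAn1S2 3 Lc cΛt) ((Lc : ℝ) ^ 4) (-((Lc : ℝ) ^ 8 / 2)) cΛ (k + j)) -
      unitS (sfStep Lc k) (smStep 3 Lc k) (ScombOf (symTablesAn1S2 3 Lc cΛt) ((Lc : ℝ) ^ 4) (-((Lc : ℝ) ^ 8 / 2)) cΛ k)) (cS * θS ^ k) δS)
    (hδS : 0 < δS) (hθS0 : 0 ≤ θS) (hθS1 : θS < 1)
    (hSp : ∀ j, LocStencil (unitS (sfStep Lc j) (smStep 3 Lc j) (SpureCombOf (symTablesAn1S2 3 Lc cΛt) ((Lc : ℝ) ^ 4) (-((Lc : ℝ) ^ 8 / 2)) cΛ j)) Cp δP)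
    (hSpall : ∀ k j, LocStencil (unitS (sfStep Lc (k + j)) (smStep 3 Lc (k + j)) (SpureCombOf (symTablesAn1S2 3 Lc cΛt) ((Lc : ℝ) ^ 4) (-((Lc : ℝ) ^ 8 / 2)) cΛ (k + j)) -
      unitS (sfStep Lc k) (smStep 3 Lc k) (SpureCombOf (symTablesAn1S2 3 Lc cΛt) ((Lc : ℝ) ^ 4) (-((Lc : ℝ) ^ 8 / 2)) cΛ k)) (cP * θP ^ k) δP)
    (hδP : 0 < δP) (hθP0 : 0 ≤ θP) (hθP1 : θP < 1)
    (hT₂ : ∀ j, LocStencil₂ (((1 : ℝ) / 2) • (unitS₂ (sfStep Lc j) (smStep 3 Lc j)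
        (T2RecOf 3 Lc (GcombSh Lc) (SpureCombOf (symTablesAn1S2 3 Lc cΛt) ((Lc : ℝ) ^ 4) (-((Lc : ℝ) ^ 8 / 2)) cΛ) (symTablesAn1S2 3 Lc cΛt).M ((Lc : ℝ) ^ 8) cB
          ((8 * (N : ℝ) ^ 2)⁻¹ • wsym22 N) (symTablesAn1S2 3 Lc cΛt).vh₂S (symTablesAn1S2 3 Lc cΛt).mixFF j) + fun κ u κ' u' =>
      sgnK (trK (unitS₂ (sfStep Lc j) (smStep 3 Lc j) (T2RecOf 3 Lc (GcombSh Lc) (SpureCombOf (symTablesAn1S2 3 Lc cΛt) ((Lc : ℝ) ^ 4) (-((Lc : ℝ) ^ 8 / 2)) cΛ)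
        (symTablesAn1S2 3 Lc cΛt).M ((Lc : ℝ) ^ 8) cB ((8 * (N : ℝ) ^ 2)⁻¹ • wsym22 N) (symTablesAn1S2 3 Lc cΛt).vh₂S (symTablesAn1S2 3 Lc cΛt).mixFF j) κ u κ' u'))))
      C₂ δ₂)
    (hT₂d : ∀ k j, LocStencil₂ (((1 : ℝ) / 2) • (unitS₂ (sfStep Lc (k + j)) (smStep 3 Lc (k + j))
          (T2RecOf 3 Lc (GcombSh Lc) (SpureCombOf (symTablesAn1S2 3 Lc cΛt) ((Lc : ℝ) ^ 4) (-((Lc : ℝ) ^ 8 / 2)) cΛ) (symTablesAn1S2 3 Lc cΛt).M ((Lc : ℝ) ^ 8) cB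
            ((8 * (N : ℝ) ^ 2)⁻¹ • wsym22 N) (symTablesAn1S2 3 Lc cΛt).vh₂S (symTablesAn1S2 3 Lc cΛt).mixFF (k + j)) + fun κ u κ' u' =>
        sgnK (trK (unitS₂ (sfStep Lc (k + j)) (smStep 3 Lc (k + j)) (T2RecOf 3 Lc (GcombSh Lc) (SpureCombOf (symTablesAn1S2 3 Lc cΛt) ((Lc : ℝ) ^ 4) (-((Lc : ℝ) ^ 8 / 2)) cΛ)
          (symTablesAn1S2 3 Lc cΛt).M ((Lc : ℝ) ^ 8) cB ((8 * (N : ℝ) ^ 2)⁻¹ • wsym22 N) (symTablesAn1S2 3 Lc cΛt).vh₂S (symTablesAn1S2 3 Lc cΛt).mixFF (k + j))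
          κ u κ' u'))) -
      ((1 : ℝ) / 2) • (unitS₂ (sfStep Lc k) (smStep 3 Lc k) (T2RecOf 3 Lc (GcombSh Lc) (SpureCombOf (symTablesAn1S2 3 Lc cΛt) ((Lc : ℝ) ^ 4) (-((Lc : ℝ) ^ 8 / 2)) cΛ)
            (symTablesAn1S2 3 Lc cΛt).M ((Lc : ℝ) ^ 8) cB ((8 * (N : ℝ) ^ 2)⁻¹ • wsym22 N) (symTablesAn1S2 3 Lc cΛt).vh₂S (symTablesAn1S2 3 Lc cΛt).mixFF k) +
        fun κ u κ' u' => sgnK (trK (unitS₂ (sfStep Lc k) (smStep 3 Lc k) (T2RecOf 3 Lc (GcombSh Lc)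
          (SpureCombOf (symTablesAn1S2 3 Lc cΛt) ((Lc : ℝ) ^ 4) (-((Lc : ℝ) ^ 8 / 2)) cΛ) (symTablesAn1S2 3 Lc cΛt).M ((Lc : ℝ) ^ 8) cB ((8 * (N : ℝ) ^ 2)⁻¹ • wsym22 N)
          (symTablesAn1S2 3 Lc cΛt).vh₂S (symTablesAn1S2 3 Lc cΛt).mixFF k) κ u κ' u')))) (c₂ * θ₂ ^ k) δ₂)
    (hδ₂ : 0 < δ₂) (hθ₂0 : 0 ≤ θ₂) (hθ₂1 : θ₂ < 1) (μ ν : Fin 4) :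
    ∃ κ θ : ℝ, 0 ≤ θ ∧ θ < 1 ∧ AllScalesSeq (fun j => B12Beta.secondMoment (TbalOf Lc (JsB12CombShSym hLc N (symTablesAn1S2 3 Lc cΛt) cΛ cB) j) μ ν) κ θ := by
  obtain ⟨Cw, cW, θW, δW, hθW0, hθW1, hδW, hW, hWall⟩ := hW_hWall_evenHalf_WcombOf_an1_three hLc2 cΛt ((Lc : ℝ) ^ 4) (-((Lc : ℝ) ^ 8 / 2)) cΛ ((Lc : ℝ) ^ 8) cB
    ((8 * (N : ℝ) ^ 2)⁻¹ • wsym22 N) hSp hSpall hδP hθP0 hθP1 hT₂ hT₂d hδ₂ hθ₂0 hθ₂1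
  exact exists_allScalesSeq_JsB12CombShSym_of_slots_evenHalf hLc hLc2 N (symTablesAn1S2 3 Lc cΛt) cΛ cB hS hSall hW hWall hδS hδW hθS0 hθS1 hθW0 hθW1 μ ν

/-- [our object; folklore composition] **ROW D1's READING `↔ lim β = stepBal` FOR an1's RECORD UNDER THE SAME ROWS** (`CombTowerEndOfSlotsK.d1Drift_JsB12CombShSym_iff_lim_eq_of_slots_evenHalf`
fed by `hW_hWall_evenHalf_WcombOf_an1_three`; the VALUE `lim β = stepBal Nc Lc` is row D1's and is NOT proved — only its equivalence with the wall term, given the rows). -/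
theorem d1Drift_JsB12CombShSym_an1_iff_lim_eq_of_slots_T2ev (hLc : Odd Lc) (hLc2 : 2 ≤ Lc) (N : ℕ) (cΛ cB : ℝ)
    (hS : ∀ j, LocStencil (unitS (sfStep Lc j) (smStep 3 Lc j) (ScombOf (symTablesAn1S2 3 Lc cΛt) ((Lc : ℝ) ^ 4) (-((Lc : ℝ) ^ 8 / 2)) cΛ j)) Cs δS)
    (hSall : ∀ k j, LocStencil (unitS (sfStep Lc (k + j)) (smStep 3 Lc (k + j)) (ScombOf (symTablesAn1S2 3 Lc cΛt) ((Lc : ℝ) ^ 4) (-((Lc : ℝ) ^ 8 / 2)) cΛ (k + j)) -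
      unitS (sfStep Lc k) (smStep 3 Lc k) (ScombOf (symTablesAn1S2 3 Lc cΛt) ((Lc : ℝ) ^ 4) (-((Lc : ℝ) ^ 8 / 2)) cΛ k)) (cS * θS ^ k) δS)
    (hδS : 0 < δS) (hθS0 : 0 ≤ θS) (hθS1 : θS < 1)
    (hSp : ∀ j, LocStencil (unitS (sfStep Lc j) (smStep 3 Lc j) (SpureCombOf (symTablesAn1S2 3 Lc cΛt) ((Lc : ℝ) ^ 4) (-((Lc : ℝ) ^ 8 / 2)) cΛ j)) Cp δP)
    (hSpall : ∀ k j, LocStencil (unitS (sfStep Lc (k + j)) (smStep 3 Lc (k + j)) (SpureCombOf (symTablesAn1S2 3 Lc cΛt) ((Lc : ℝ) ^ 4) (-((Lc : ℝ) ^ 8 / 2)) cΛ (k + j)) -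
      unitS (sfStep Lc k) (smStep 3 Lc k) (SpureCombOf (symTablesAn1S2 3 Lc cΛt) ((Lc : ℝ) ^ 4) (-((Lc : ℝ) ^ 8 / 2)) cΛ k)) (cP * θP ^ k) δP)
    (hδP : 0 < δP) (hθP0 : 0 ≤ θP) (hθP1 : θP < 1)
    (hT₂ : ∀ j, LocStencil₂ (((1 : ℝ) / 2) • (unitS₂ (sfStep Lc j) (smStep 3 Lc j)
        (T2RecOf 3 Lc (GcombSh Lc) (SpureCombOf (symTablesAn1S2 3 Lc cΛt) ((Lc : ℝ) ^ 4) (-((Lc : ℝ) ^ 8 / 2)) cΛ) (symTablesAn1S2 3 Lc cΛt).M ((Lc : ℝ) ^ 8) cB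
          ((8 * (N : ℝ) ^ 2)⁻¹ • wsym22 N) (symTablesAn1S2 3 Lc cΛt).vh₂S (symTablesAn1S2 3 Lc cΛt).mixFF j) + fun κ u κ' u' =>
      sgnK (trK (unitS₂ (sfStep Lc j) (smStep 3 Lc j) (T2RecOf 3 Lc (GcombSh Lc) (SpureCombOf (symTablesAn1S2 3 Lc cΛt) ((Lc : ℝ) ^ 4) (-((Lc : ℝ) ^ 8 / 2)) cΛ)
        (symTablesAn1S2 3 Lc cΛt).M ((Lc : ℝ) ^ 8) cB ((8 * (N : ℝ) ^ 2)⁻¹ • wsym22 N) (symTablesAn1S2 3 Lc cΛt).vh₂S (symTablesAn1S2 3 Lc cΛt).mixFF j) κ u κ' u'))))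
      C₂ δ₂)
    (hT₂d : ∀ k j, LocStencil₂ (((1 : ℝ) / 2) • (unitS₂ (sfStep Lc (k + j)) (smStep 3 Lc (k + j))
          (T2RecOf 3 Lc (GcombSh Lc) (SpureCombOf (symTablesAn1S2 3 Lc cΛt) ((Lc : ℝ) ^ 4) (-((Lc : ℝ) ^ 8 / 2)) cΛ) (symTablesAn1S2 3 Lc cΛt).M ((Lc : ℝ) ^ 8) cB
            ((8 * (N : ℝ) ^ 2)⁻¹ • wsym22 N) (symTablesAn1S2 3 Lc cΛt).vh₂S (symTablesAn1S2 3 Lc cΛt).mixFF (k + j)) + fun κ u κ' u' =>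
        sgnK (trK (unitS₂ (sfStep Lc (k + j)) (smStep 3 Lc (k + j)) (T2RecOf 3 Lc (GcombSh Lc) (SpureCombOf (symTablesAn1S2 3 Lc cΛt) ((Lc : ℝ) ^ 4) (-((Lc : ℝ) ^ 8 / 2)) cΛ)
          (symTablesAn1S2 3 Lc cΛt).M ((Lc : ℝ) ^ 8) cB ((8 * (N : ℝ) ^ 2)⁻¹ • wsym22 N) (symTablesAn1S2 3 Lc cΛt).vh₂S (symTablesAn1S2 3 Lc cΛt).mixFF (k + j))
          κ u κ' u'))) -
      ((1 : ℝ) / 2) • (unitS₂ (sfStep Lc k) (smStep 3 Lc k) (T2RecOf 3 Lc (GcombSh Lc) (SpureCombOf (symTablesAn1S2 3 Lc cΛt) ((Lc : ℝ) ^ 4) (-((Lc : ℝ) ^ 8 / 2)) cΛ)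
            (symTablesAn1S2 3 Lc cΛt).M ((Lc : ℝ) ^ 8) cB ((8 * (N : ℝ) ^ 2)⁻¹ • wsym22 N) (symTablesAn1S2 3 Lc cΛt).vh₂S (symTablesAn1S2 3 Lc cΛt).mixFF k) +
        fun κ u κ' u' => sgnK (trK (unitS₂ (sfStep Lc k) (smStep 3 Lc k) (T2RecOf 3 Lc (GcombSh Lc)
          (SpureCombOf (symTablesAn1S2 3 Lc cΛt) ((Lc : ℝ) ^ 4) (-((Lc : ℝ) ^ 8 / 2)) cΛ) (symTablesAn1S2 3 Lc cΛt).M ((Lc : ℝ) ^ 8) cB ((8 * (N : ℝ) ^ 2)⁻¹ • wsym22 N)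
          (symTablesAn1S2 3 Lc cΛt).vh₂S (symTablesAn1S2 3 Lc cΛt).mixFF k) κ u κ' u')))) (c₂ * θ₂ ^ k) δ₂)
    (hδ₂ : 0 < δ₂) (hθ₂0 : 0 ≤ θ₂) (hθ₂1 : θ₂ < 1) (μ ν : Fin 4) (Nc : ℝ) :
    D1Drift Lc (JsB12CombShSym hLc N (symTablesAn1S2 3 Lc cΛt) cΛ cB) Nc μ ν ↔
      RateCertificate.CauchyRate.lim (fun j => B12Beta.secondMoment (TbalOf Lc (JsB12CombShSym hLc N (symTablesAn1S2 3 Lc cΛt) cΛ cB) j) μ ν) =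
        B12Normalization.stepBal Nc Lc := by
  obtain ⟨Cw, cW, θW, δW, hθW0, hθW1, hδW, hW, hWall⟩ := hW_hWall_evenHalf_WcombOf_an1_three hLc2 cΛt ((Lc : ℝ) ^ 4) (-((Lc : ℝ) ^ 8 / 2)) cΛ ((Lc : ℝ) ^ 8) cB
    ((8 * (N : ℝ) ^ 2)⁻¹ • wsym22 N) hSp hSpall hδP hθP0 hθP1 hT₂ hT₂d hδ₂ hθ₂0 hθ₂1
  exact d1Drift_JsB12CombShSym_iff_lim_eq_of_slots_evenHalf hLc hLc2 N (symTablesAn1S2 3 Lc cΛt) cΛ cB hS hSall hW hWall hδS hδW hθS0 hθS1 hθW0 hθW1 μ ν Nc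

/-- [our object; folklore composition] **ROW D1's CESÀRO READING FOR an1's RECORD UNDER THE SAME ROWS** (`CombTowerEndOfSlotsK.d1Drift_JsB12CombShSym_iff_cesaro_of_slots_evenHalf` likewise). -/
theorem d1Drift_JsB12CombShSym_an1_iff_cesaro_of_slots_T2ev (hLc : Odd Lc) (hLc2 : 2 ≤ Lc) (N : ℕ) (cΛ cB : ℝ)
    (hS : ∀ j, LocStencil (unitS (sfStep Lc j) (smStep 3 Lc j) (ScombOf (symTablesAn1S2 3 Lc cΛt) ((Lc : ℝ) ^ 4) (-((Lc : ℝ) ^ 8 / 2)) cΛ j)) Cs δS)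
    (hSall : ∀ k j, LocStencil (unitS (sfStep Lc (k + j)) (smStep 3 Lc (k + j)) (ScombOf (symTablesAn1S2 3 Lc cΛt) ((Lc : ℝ) ^ 4) (-((Lc : ℝ) ^ 8 / 2)) cΛ (k + j)) -
      unitS (sfStep Lc k) (smStep 3 Lc k) (ScombOf (symTablesAn1S2 3 Lc cΛt) ((Lc : ℝ) ^ 4) (-((Lc : ℝ) ^ 8 / 2)) cΛ k)) (cS * θS ^ k) δS)
    (hδS : 0 < δS) (hθS0 : 0 ≤ θS) (hθS1 : θS < 1)
    (hSp : ∀ j, LocStencil (unitS (sfStep Lc j) (smStep 3 Lc j) (SpureCombOf (symTablesAn1S2 3 Lc cΛt) ((Lc : ℝ) ^ 4) (-((Lc : ℝ) ^ 8 / 2)) cΛ j)) Cp δP)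
    (hSpall : ∀ k j, LocStencil (unitS (sfStep Lc (k + j)) (smStep 3 Lc (k + j)) (SpureCombOf (symTablesAn1S2 3 Lc cΛt) ((Lc : ℝ) ^ 4) (-((Lc : ℝ) ^ 8 / 2)) cΛ (k + j)) -
      unitS (sfStep Lc k) (smStep 3 Lc k) (SpureCombOf (symTablesAn1S2 3 Lc cΛt) ((Lc : ℝ) ^ 4) (-((Lc : ℝ) ^ 8 / 2)) cΛ k)) (cP * θP ^ k) δP)
    (hδP : 0 < δP) (hθP0 : 0 ≤ θP) (hθP1 : θP < 1)
    (hT₂ : ∀ j, LocStencil₂ (((1 : ℝ) / 2) • (unitS₂ (sfStep Lc j) (smStep 3 Lc j)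
        (T2RecOf 3 Lc (GcombSh Lc) (SpureCombOf (symTablesAn1S2 3 Lc cΛt) ((Lc : ℝ) ^ 4) (-((Lc : ℝ) ^ 8 / 2)) cΛ) (symTablesAn1S2 3 Lc cΛt).M ((Lc : ℝ) ^ 8) cB
          ((8 * (N : ℝ) ^ 2)⁻¹ • wsym22 N) (symTablesAn1S2 3 Lc cΛt).vh₂S (symTablesAn1S2 3 Lc cΛt).mixFF j) + fun κ u κ' u' =>
      sgnK (trK (unitS₂ (sfStep Lc j) (smStep 3 Lc j) (T2RecOf 3 Lc (GcombSh Lc) (SpureCombOf (symTablesAn1S2 3 Lc cΛt) ((Lc : ℝ) ^ 4) (-((Lc : ℝ) ^ 8 / 2)) cΛ)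
        (symTablesAn1S2 3 Lc cΛt).M ((Lc : ℝ) ^ 8) cB ((8 * (N : ℝ) ^ 2)⁻¹ • wsym22 N) (symTablesAn1S2 3 Lc cΛt).vh₂S (symTablesAn1S2 3 Lc cΛt).mixFF j) κ u κ' u'))))
      C₂ δ₂)
    (hT₂d : ∀ k j, LocStencil₂ (((1 : ℝ) / 2) • (unitS₂ (sfStep Lc (k + j)) (smStep 3 Lc (k + j))
          (T2RecOf 3 Lc (GcombSh Lc) (SpureCombOf (symTablesAn1S2 3 Lc cΛt) ((Lc : ℝ) ^ 4) (-((Lc : ℝ) ^ 8 / 2)) cΛ) (symTablesAn1S2 3 Lc cΛt).M ((Lc : ℝ) ^ 8) cB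
            ((8 * (N : ℝ) ^ 2)⁻¹ • wsym22 N) (symTablesAn1S2 3 Lc cΛt).vh₂S (symTablesAn1S2 3 Lc cΛt).mixFF (k + j)) + fun κ u κ' u' =>
        sgnK (trK (unitS₂ (sfStep Lc (k + j)) (smStep 3 Lc (k + j)) (T2RecOf 3 Lc (GcombSh Lc) (SpureCombOf (symTablesAn1S2 3 Lc cΛt) ((Lc : ℝ) ^ 4) (-((Lc : ℝ) ^ 8 / 2)) cΛ)
          (symTablesAn1S2 3 Lc cΛt).M ((Lc : ℝ) ^ 8) cB ((8 * (N : ℝ) ^ 2)⁻¹ • wsym22 N) (symTablesAn1S2 3 Lc cΛt).vh₂S (symTablesAn1S2 3 Lc cΛt).mixFF (k + j))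
          κ u κ' u'))) -
      ((1 : ℝ) / 2) • (unitS₂ (sfStep Lc k) (smStep 3 Lc k) (T2RecOf 3 Lc (GcombSh Lc) (SpureCombOf (symTablesAn1S2 3 Lc cΛt) ((Lc : ℝ) ^ 4) (-((Lc : ℝ) ^ 8 / 2)) cΛ)
            (symTablesAn1S2 3 Lc cΛt).M ((Lc : ℝ) ^ 8) cB ((8 * (N : ℝ) ^ 2)⁻¹ • wsym22 N) (symTablesAn1S2 3 Lc cΛt).vh₂S (symTablesAn1S2 3 Lc cΛt).mixFF k) +
        fun κ u κ' u' => sgnK (trK (unitS₂ (sfStep Lc k) (smStep 3 Lc k) (T2RecOf 3 Lc (GcombSh Lc)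
          (SpureCombOf (symTablesAn1S2 3 Lc cΛt) ((Lc : ℝ) ^ 4) (-((Lc : ℝ) ^ 8 / 2)) cΛ) (symTablesAn1S2 3 Lc cΛt).M ((Lc : ℝ) ^ 8) cB ((8 * (N : ℝ) ^ 2)⁻¹ • wsym22 N)
          (symTablesAn1S2 3 Lc cΛt).vh₂S (symTablesAn1S2 3 Lc cΛt).mixFF k) κ u κ' u')))) (c₂ * θ₂ ^ k) δ₂)
    (hδ₂ : 0 < δ₂) (hθ₂0 : 0 ≤ θ₂) (hθ₂1 : θ₂ < 1) (μ ν : Fin 4) (Nc : ℝ) :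
    D1Drift Lc (JsB12CombShSym hLc N (symTablesAn1S2 3 Lc cΛt) cΛ cB) Nc μ ν ↔
      Tendsto (fun m : ℕ => (∑ j ∈ Finset.range m, B12Beta.secondMoment (TbalOf Lc (JsB12CombShSym hLc N (symTablesAn1S2 3 Lc cΛt) cΛ cB) j) μ ν) / (m : ℝ))
        atTop (𝓝 (B12Normalization.stepBal Nc Lc)) := by
  obtain ⟨Cw, cW, θW, δW, hθW0, hθW1, hδW, hW, hWall⟩ := hW_hWall_evenHalf_WcombOf_an1_three hLc2 cΛt ((Lc : ℝ) ^ 4) (-((Lc : ℝ) ^ 8 / 2)) cΛ ((Lc : ℝ) ^ 8) cB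
    ((8 * (N : ℝ) ^ 2)⁻¹ • wsym22 N) hSp hSpall hδP hθP0 hθP1 hT₂ hT₂d hδ₂ hθ₂0 hθ₂1
  exact d1Drift_JsB12CombShSym_iff_cesaro_of_slots_evenHalf hLc hLc2 N (symTablesAn1S2 3 Lc cΛt) cΛ cB hS hSall hW hWall hδS hδW hθS0 hθS1 hθW0 hθW1 μ ν Nc

end An1

/-! ## §3 an1's record, S′-ROWS DISCHARGED: the END and row D1's readings ⟸ S-rows ∧ «T2Shape^{ev}» ∧ «T2Drift^{ev}» ONLY (v1.1, APPEND-ONLY) -/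

section An1SRows

variable (cΛt : ℝ)

/-- [our object; folklore composition] **THE G-an2-4 END AT (III′) FOR an1's RECORD ⟸ THE S-ROWS OF `ScombOf` AND THE TWO T₂ ROWS ONLY** (`Lc` odd, `2 ≤ Lc`): §2's
`exists_allScalesSeq_JsB12CombShSym_an1_of_slots_T2ev` with its S′-rows `(hSp, hSpall)` on `unitS_j (SpureCombOf …)` SUPPLIED from `(hS, hSall)` by
`CombSpureRowsOfSRows.exists_spureCombOf_rows_three_of_scombOf_rows` (the peel `S′ = S − Λ(H)` and the rooted Λ rows over an1's `symHessFFAt`, K by `convCKWall_holds`). -/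
theorem exists_allScalesSeq_JsB12CombShSym_an1_of_sRows_T2ev (hLc : Odd Lc) (hLc2 : 2 ≤ Lc) (N : ℕ) (cΛ cB : ℝ)
    (hS : ∀ j, LocStencil (unitS (sfStep Lc j) (smStep 3 Lc j) (ScombOf (symTablesAn1S2 3 Lc cΛt) ((Lc : ℝ) ^ 4) (-((Lc : ℝ) ^ 8 / 2)) cΛ j)) Cs δS)
    (hSall : ∀ k j, LocStencil (unitS (sfStep Lc (k + j)) (smStep 3 Lc (k + j)) (ScombOf (symTablesAn1S2 3 Lc cΛt) ((Lc : ℝ) ^ 4) (-((Lc : ℝ) ^ 8 / 2)) cΛ (k + j)) -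
      unitS (sfStep Lc k) (smStep 3 Lc k) (ScombOf (symTablesAn1S2 3 Lc cΛt) ((Lc : ℝ) ^ 4) (-((Lc : ℝ) ^ 8 / 2)) cΛ k)) (cS * θS ^ k) δS)
    (hδS : 0 < δS) (hθS0 : 0 ≤ θS) (hθS1 : θS < 1)
    (hT₂ : ∀ j, LocStencil₂ (((1 : ℝ) / 2) • (unitS₂ (sfStep Lc j) (smStep 3 Lc j)
        (T2RecOf 3 Lc (GcombSh Lc) (SpureCombOf (symTablesAn1S2 3 Lc cΛt) ((Lc : ℝ) ^ 4) (-((Lc : ℝ) ^ 8 / 2)) cΛ) (symTablesAn1S2 3 Lc cΛt).M ((Lc : ℝ) ^ 8) cB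
          ((8 * (N : ℝ) ^ 2)⁻¹ • wsym22 N) (symTablesAn1S2 3 Lc cΛt).vh₂S (symTablesAn1S2 3 Lc cΛt).mixFF j) + fun κ u κ' u' =>
      sgnK (trK (unitS₂ (sfStep Lc j) (smStep 3 Lc j) (T2RecOf 3 Lc (GcombSh Lc) (SpureCombOf (symTablesAn1S2 3 Lc cΛt) ((Lc : ℝ) ^ 4) (-((Lc : ℝ) ^ 8 / 2)) cΛ)
        (symTablesAn1S2 3 Lc cΛt).M ((Lc : ℝ) ^ 8) cB ((8 * (N : ℝ) ^ 2)⁻¹ • wsym22 N) (symTablesAn1S2 3 Lc cΛt).vh₂S (symTablesAn1S2 3 Lc cΛt).mixFF j) κ u κ' u'))))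
      C₂ δ₂)
    (hT₂d : ∀ k j, LocStencil₂ (((1 : ℝ) / 2) • (unitS₂ (sfStep Lc (k + j)) (smStep 3 Lc (k + j))
          (T2RecOf 3 Lc (GcombSh Lc) (SpureCombOf (symTablesAn1S2 3 Lc cΛt) ((Lc : ℝ) ^ 4) (-((Lc : ℝ) ^ 8 / 2)) cΛ) (symTablesAn1S2 3 Lc cΛt).M ((Lc : ℝ) ^ 8) cB
            ((8 * (N : ℝ) ^ 2)⁻¹ • wsym22 N) (symTablesAn1S2 3 Lc cΛt).vh₂S (symTablesAn1S2 3 Lc cΛt).mixFF (k + j)) + fun κ u κ' u' =>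
        sgnK (trK (unitS₂ (sfStep Lc (k + j)) (smStep 3 Lc (k + j)) (T2RecOf 3 Lc (GcombSh Lc) (SpureCombOf (symTablesAn1S2 3 Lc cΛt) ((Lc : ℝ) ^ 4) (-((Lc : ℝ) ^ 8 / 2)) cΛ)
          (symTablesAn1S2 3 Lc cΛt).M ((Lc : ℝ) ^ 8) cB ((8 * (N : ℝ) ^ 2)⁻¹ • wsym22 N) (symTablesAn1S2 3 Lc cΛt).vh₂S (symTablesAn1S2 3 Lc cΛt).mixFF (k + j))
          κ u κ' u'))) -
      ((1 : ℝ) / 2) • (unitS₂ (sfStep Lc k) (smStep 3 Lc k) (T2RecOf 3 Lc (GcombSh Lc) (SpureCombOf (symTablesAn1S2 3 Lc cΛt) ((Lc : ℝ) ^ 4) (-((Lc : ℝ) ^ 8 / 2)) cΛ)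
            (symTablesAn1S2 3 Lc cΛt).M ((Lc : ℝ) ^ 8) cB ((8 * (N : ℝ) ^ 2)⁻¹ • wsym22 N) (symTablesAn1S2 3 Lc cΛt).vh₂S (symTablesAn1S2 3 Lc cΛt).mixFF k) +
        fun κ u κ' u' => sgnK (trK (unitS₂ (sfStep Lc k) (smStep 3 Lc k) (T2RecOf 3 Lc (GcombSh Lc)
          (SpureCombOf (symTablesAn1S2 3 Lc cΛt) ((Lc : ℝ) ^ 4) (-((Lc : ℝ) ^ 8 / 2)) cΛ) (symTablesAn1S2 3 Lc cΛt).M ((Lc : ℝ) ^ 8) cB ((8 * (N : ℝ) ^ 2)⁻¹ • wsym22 N)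
          (symTablesAn1S2 3 Lc cΛt).vh₂S (symTablesAn1S2 3 Lc cΛt).mixFF k) κ u κ' u')))) (c₂ * θ₂ ^ k) δ₂)
    (hδ₂ : 0 < δ₂) (hθ₂0 : 0 ≤ θ₂) (hθ₂1 : θ₂ < 1) (μ ν : Fin 4) :
    ∃ κ θ : ℝ, 0 ≤ θ ∧ θ < 1 ∧ AllScalesSeq (fun j => B12Beta.secondMoment (TbalOf Lc (JsB12CombShSym hLc N (symTablesAn1S2 3 Lc cΛt) cΛ cB) j) μ ν) κ θ := by
  obtain ⟨Cp, cP, θP, δP, hθP0, hθP1, hδP, hSp, hSpall⟩ :=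
    exists_spureCombOf_rows_three_of_scombOf_rows hLc2 cΛt ((Lc : ℝ) ^ 4) (-((Lc : ℝ) ^ 8 / 2)) cΛ hS hSall hδS hθS0 hθS1
  exact exists_allScalesSeq_JsB12CombShSym_an1_of_slots_T2ev cΛt hLc hLc2 N cΛ cB hS hSall hδS hθS0 hθS1 hSp hSpall hδP hθP0 hθP1 hT₂ hT₂d hδ₂ hθ₂0 hθ₂1 μ ν

/-- [our object; folklore composition] **ROW D1's READING `↔ lim β = stepBal` FOR an1's RECORD ⟸ THE S-ROWS AND THE TWO T₂ ROWS ONLY** (§2's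
`d1Drift_JsB12CombShSym_an1_iff_lim_eq_of_slots_T2ev`, S′-rows by `exists_spureCombOf_rows_three_of_scombOf_rows`; the VALUE `lim β = stepBal Nc Lc` is row D1's, NOT proved). -/
theorem d1Drift_JsB12CombShSym_an1_iff_lim_eq_of_sRows_T2ev (hLc : Odd Lc) (hLc2 : 2 ≤ Lc) (N : ℕ) (cΛ cB : ℝ)
    (hS : ∀ j, LocStencil (unitS (sfStep Lc j) (smStep 3 Lc j) (ScombOf (symTablesAn1S2 3 Lc cΛt) ((Lc : ℝ) ^ 4) (-((Lc : ℝ) ^ 8 / 2)) cΛ j)) Cs δS)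
    (hSall : ∀ k j, LocStencil (unitS (sfStep Lc (k + j)) (smStep 3 Lc (k + j)) (ScombOf (symTablesAn1S2 3 Lc cΛt) ((Lc : ℝ) ^ 4) (-((Lc : ℝ) ^ 8 / 2)) cΛ (k + j)) -
      unitS (sfStep Lc k) (smStep 3 Lc k) (ScombOf (symTablesAn1S2 3 Lc cΛt) ((Lc : ℝ) ^ 4) (-((Lc : ℝ) ^ 8 / 2)) cΛ k)) (cS * θS ^ k) δS)
    (hδS : 0 < δS) (hθS0 : 0 ≤ θS) (hθS1 : θS < 1)
    (hT₂ : ∀ j, LocStencil₂ (((1 : ℝ) / 2) • (unitS₂ (sfStep Lc j) (smStep 3 Lc j)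
        (T2RecOf 3 Lc (GcombSh Lc) (SpureCombOf (symTablesAn1S2 3 Lc cΛt) ((Lc : ℝ) ^ 4) (-((Lc : ℝ) ^ 8 / 2)) cΛ) (symTablesAn1S2 3 Lc cΛt).M ((Lc : ℝ) ^ 8) cB
          ((8 * (N : ℝ) ^ 2)⁻¹ • wsym22 N) (symTablesAn1S2 3 Lc cΛt).vh₂S (symTablesAn1S2 3 Lc cΛt).mixFF j) + fun κ u κ' u' =>
      sgnK (trK (unitS₂ (sfStep Lc j) (smStep 3 Lc j) (T2RecOf 3 Lc (GcombSh Lc) (SpureCombOf (symTablesAn1S2 3 Lc cΛt) ((Lc : ℝ) ^ 4) (-((Lc : ℝ) ^ 8 / 2)) cΛ)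
        (symTablesAn1S2 3 Lc cΛt).M ((Lc : ℝ) ^ 8) cB ((8 * (N : ℝ) ^ 2)⁻¹ • wsym22 N) (symTablesAn1S2 3 Lc cΛt).vh₂S (symTablesAn1S2 3 Lc cΛt).mixFF j) κ u κ' u'))))
      C₂ δ₂)
    (hT₂d : ∀ k j, LocStencil₂ (((1 : ℝ) / 2) • (unitS₂ (sfStep Lc (k + j)) (smStep 3 Lc (k + j))
          (T2RecOf 3 Lc (GcombSh Lc) (SpureCombOf (symTablesAn1S2 3 Lc cΛt) ((Lc : ℝ) ^ 4) (-((Lc : ℝ) ^ 8 / 2)) cΛ) (symTablesAn1S2 3 Lc cΛt).M ((Lc : ℝ) ^ 8) cB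
            ((8 * (N : ℝ) ^ 2)⁻¹ • wsym22 N) (symTablesAn1S2 3 Lc cΛt).vh₂S (symTablesAn1S2 3 Lc cΛt).mixFF (k + j)) + fun κ u κ' u' =>
        sgnK (trK (unitS₂ (sfStep Lc (k + j)) (smStep 3 Lc (k + j)) (T2RecOf 3 Lc (GcombSh Lc) (SpureCombOf (symTablesAn1S2 3 Lc cΛt) ((Lc : ℝ) ^ 4) (-((Lc : ℝ) ^ 8 / 2)) cΛ)
          (symTablesAn1S2 3 Lc cΛt).M ((Lc : ℝ) ^ 8) cB ((8 * (N : ℝ) ^ 2)⁻¹ • wsym22 N) (symTablesAn1S2 3 Lc cΛt).vh₂S (symTablesAn1S2 3 Lc cΛt).mixFF (k + j))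
          κ u κ' u'))) -
      ((1 : ℝ) / 2) • (unitS₂ (sfStep Lc k) (smStep 3 Lc k) (T2RecOf 3 Lc (GcombSh Lc) (SpureCombOf (symTablesAn1S2 3 Lc cΛt) ((Lc : ℝ) ^ 4) (-((Lc : ℝ) ^ 8 / 2)) cΛ)
            (symTablesAn1S2 3 Lc cΛt).M ((Lc : ℝ) ^ 8) cB ((8 * (N : ℝ) ^ 2)⁻¹ • wsym22 N) (symTablesAn1S2 3 Lc cΛt).vh₂S (symTablesAn1S2 3 Lc cΛt).mixFF k) +
        fun κ u κ' u' => sgnK (trK (unitS₂ (sfStep Lc k) (smStep 3 Lc k) (T2RecOf 3 Lc (GcombSh Lc)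
          (SpureCombOf (symTablesAn1S2 3 Lc cΛt) ((Lc : ℝ) ^ 4) (-((Lc : ℝ) ^ 8 / 2)) cΛ) (symTablesAn1S2 3 Lc cΛt).M ((Lc : ℝ) ^ 8) cB ((8 * (N : ℝ) ^ 2)⁻¹ • wsym22 N)
          (symTablesAn1S2 3 Lc cΛt).vh₂S (symTablesAn1S2 3 Lc cΛt).mixFF k) κ u κ' u')))) (c₂ * θ₂ ^ k) δ₂)
    (hδ₂ : 0 < δ₂) (hθ₂0 : 0 ≤ θ₂) (hθ₂1 : θ₂ < 1) (μ ν : Fin 4) (Nc : ℝ) :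
    D1Drift Lc (JsB12CombShSym hLc N (symTablesAn1S2 3 Lc cΛt) cΛ cB) Nc μ ν ↔
      RateCertificate.CauchyRate.lim (fun j => B12Beta.secondMoment (TbalOf Lc (JsB12CombShSym hLc N (symTablesAn1S2 3 Lc cΛt) cΛ cB) j) μ ν) =
        B12Normalization.stepBal Nc Lc := by
  obtain ⟨Cp, cP, θP, δP, hθP0, hθP1, hδP, hSp, hSpall⟩ :=
    exists_spureCombOf_rows_three_of_scombOf_rows hLc2 cΛt ((Lc : ℝ) ^ 4) (-((Lc : ℝ) ^ 8 / 2)) cΛ hS hSall hδS hθS0 hθS1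
  exact d1Drift_JsB12CombShSym_an1_iff_lim_eq_of_slots_T2ev cΛt hLc hLc2 N cΛ cB hS hSall hδS hθS0 hθS1 hSp hSpall hδP hθP0 hθP1 hT₂ hT₂d hδ₂ hθ₂0 hθ₂1 μ ν Nc

/-- [our object; folklore composition] **ROW D1's CESÀRO READING FOR an1's RECORD ⟸ THE S-ROWS AND THE TWO T₂ ROWS ONLY** (§2's
`d1Drift_JsB12CombShSym_an1_iff_cesaro_of_slots_T2ev`, S′-rows by `exists_spureCombOf_rows_three_of_scombOf_rows`). -/
theorem d1Drift_JsB12CombShSym_an1_iff_cesaro_of_sRows_T2ev (hLc : Odd Lc) (hLc2 : 2 ≤ Lc) (N : ℕ) (cΛ cB : ℝ)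
    (hS : ∀ j, LocStencil (unitS (sfStep Lc j) (smStep 3 Lc j) (ScombOf (symTablesAn1S2 3 Lc cΛt) ((Lc : ℝ) ^ 4) (-((Lc : ℝ) ^ 8 / 2)) cΛ j)) Cs δS)
    (hSall : ∀ k j, LocStencil (unitS (sfStep Lc (k + j)) (smStep 3 Lc (k + j)) (ScombOf (symTablesAn1S2 3 Lc cΛt) ((Lc : ℝ) ^ 4) (-((Lc : ℝ) ^ 8 / 2)) cΛ (k + j)) -
      unitS (sfStep Lc k) (smStep 3 Lc k) (ScombOf (symTablesAn1S2 3 Lc cΛt) ((Lc : ℝ) ^ 4) (-((Lc : ℝ) ^ 8 / 2)) cΛ k)) (cS * θS ^ k) δS)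
    (hδS : 0 < δS) (hθS0 : 0 ≤ θS) (hθS1 : θS < 1)
    (hT₂ : ∀ j, LocStencil₂ (((1 : ℝ) / 2) • (unitS₂ (sfStep Lc j) (smStep 3 Lc j)
        (T2RecOf 3 Lc (GcombSh Lc) (SpureCombOf (symTablesAn1S2 3 Lc cΛt) ((Lc : ℝ) ^ 4) (-((Lc : ℝ) ^ 8 / 2)) cΛ) (symTablesAn1S2 3 Lc cΛt).M ((Lc : ℝ) ^ 8) cB
          ((8 * (N : ℝ) ^ 2)⁻¹ • wsym22 N) (symTablesAn1S2 3 Lc cΛt).vh₂S (symTablesAn1S2 3 Lc cΛt).mixFF j) + fun κ u κ' u' =>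
      sgnK (trK (unitS₂ (sfStep Lc j) (smStep 3 Lc j) (T2RecOf 3 Lc (GcombSh Lc) (SpureCombOf (symTablesAn1S2 3 Lc cΛt) ((Lc : ℝ) ^ 4) (-((Lc : ℝ) ^ 8 / 2)) cΛ)
        (symTablesAn1S2 3 Lc cΛt).M ((Lc : ℝ) ^ 8) cB ((8 * (N : ℝ) ^ 2)⁻¹ • wsym22 N) (symTablesAn1S2 3 Lc cΛt).vh₂S (symTablesAn1S2 3 Lc cΛt).mixFF j) κ u κ' u'))))
      C₂ δ₂)
    (hT₂d : ∀ k j, LocStencil₂ (((1 : ℝ) / 2) • (unitS₂ (sfStep Lc (k + j)) (smStep 3 Lc (k + j))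
          (T2RecOf 3 Lc (GcombSh Lc) (SpureCombOf (symTablesAn1S2 3 Lc cΛt) ((Lc : ℝ) ^ 4) (-((Lc : ℝ) ^ 8 / 2)) cΛ) (symTablesAn1S2 3 Lc cΛt).M ((Lc : ℝ) ^ 8) cB
            ((8 * (N : ℝ) ^ 2)⁻¹ • wsym22 N) (symTablesAn1S2 3 Lc cΛt).vh₂S (symTablesAn1S2 3 Lc cΛt).mixFF (k + j)) + fun κ u κ' u' =>
        sgnK (trK (unitS₂ (sfStep Lc (k + j)) (smStep 3 Lc (k + j)) (T2RecOf 3 Lc (GcombSh Lc) (SpureCombOf (symTablesAn1S2 3 Lc cΛt) ((Lc : ℝ) ^ 4) (-((Lc : ℝ) ^ 8 / 2)) cΛ)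
          (symTablesAn1S2 3 Lc cΛt).M ((Lc : ℝ) ^ 8) cB ((8 * (N : ℝ) ^ 2)⁻¹ • wsym22 N) (symTablesAn1S2 3 Lc cΛt).vh₂S (symTablesAn1S2 3 Lc cΛt).mixFF (k + j))
          κ u κ' u'))) -
      ((1 : ℝ) / 2) • (unitS₂ (sfStep Lc k) (smStep 3 Lc k) (T2RecOf 3 Lc (GcombSh Lc) (SpureCombOf (symTablesAn1S2 3 Lc cΛt) ((Lc : ℝ) ^ 4) (-((Lc : ℝ) ^ 8 / 2)) cΛ)
            (symTablesAn1S2 3 Lc cΛt).M ((Lc : ℝ) ^ 8) cB ((8 * (N : ℝ) ^ 2)⁻¹ • wsym22 N) (symTablesAn1S2 3 Lc cΛt).vh₂S (symTablesAn1S2 3 Lc cΛt).mixFF k) +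
        fun κ u κ' u' => sgnK (trK (unitS₂ (sfStep Lc k) (smStep 3 Lc k) (T2RecOf 3 Lc (GcombSh Lc)
          (SpureCombOf (symTablesAn1S2 3 Lc cΛt) ((Lc : ℝ) ^ 4) (-((Lc : ℝ) ^ 8 / 2)) cΛ) (symTablesAn1S2 3 Lc cΛt).M ((Lc : ℝ) ^ 8) cB ((8 * (N : ℝ) ^ 2)⁻¹ • wsym22 N)
          (symTablesAn1S2 3 Lc cΛt).vh₂S (symTablesAn1S2 3 Lc cΛt).mixFF k) κ u κ' u')))) (c₂ * θ₂ ^ k) δ₂)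
    (hδ₂ : 0 < δ₂) (hθ₂0 : 0 ≤ θ₂) (hθ₂1 : θ₂ < 1) (μ ν : Fin 4) (Nc : ℝ) :
    D1Drift Lc (JsB12CombShSym hLc N (symTablesAn1S2 3 Lc cΛt) cΛ cB) Nc μ ν ↔
      Tendsto (fun m : ℕ => (∑ j ∈ Finset.range m, B12Beta.secondMoment (TbalOf Lc (JsB12CombShSym hLc N (symTablesAn1S2 3 Lc cΛt) cΛ cB) j) μ ν) / (m : ℝ))
        atTop (𝓝 (B12Normalization.stepBal Nc Lc)) := by
  obtain ⟨Cp, cP, θP, δP, hθP0, hθP1, hδP, hSp, hSpall⟩ :=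
    exists_spureCombOf_rows_three_of_scombOf_rows hLc2 cΛt ((Lc : ℝ) ^ 4) (-((Lc : ℝ) ^ 8 / 2)) cΛ hS hSall hδS hθS0 hθS1
  exact d1Drift_JsB12CombShSym_an1_iff_cesaro_of_slots_T2ev cΛt hLc hLc2 N cΛ cB hS hSall hδS hθS0 hθS1 hSp hSpall hδP hθP0 hθP1 hT₂ hT₂d hδ₂ hθ₂0 hθ₂1 μ ν Nc

end An1SRows

end Summit.QuantumFields.BalabanUV.Beta.GAN24.CombTowerEndOfT2ev

end
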